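/-
Copyright (c) 2026 the pub-hodgecm-mathlib formalisation cell (harness21).  Prover seat hodgecm-mathlib-K2E4-p10 (g9), Track B «K2-LIT»,
#184♮ = hLiu418 = `stmt-HodgeConjecture-24832`; socket #41 `sig_K2LiuSiegelEisensteinContinuation`, KIND W (n = 2), THE TIE-SIDE PAYER HEAD OF RECORD
`kindW_block_of_record` (LEAD F0P6-plan (g14) BATCH #110 (3) ∕ #112 (3)): the TOP's KIND-W block at the TOP's own letters, by value from ★ (x-a) ED. 3 + ★ STAGE 2 + ★ STAGE 1.
THEOREMS ONLY (no `def`, no `instance`, no notation, no named-fact hypothesis, no `sorry`).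
-/
import Summits.HodgeConjecture.HodgeConjecture.Theorems.K2LiuSiegelEisensteinKindWEulerLetters      -- ★ p862754 (x-a) ED. 3 `exists_kindW_eulerLetters_of_letters` (⊇ ★ ED. 1–2 `kindWPlaces`, `kindWFinset`)
import Summits.HodgeConjecture.HodgeConjecture.Theorems.K2LiuSiegelEisensteinKindWGlobalIntegrable   -- ★ p862776 (x-a) `hG_of_isStandardSectionFamily` (the letter `hG` PAID)
import Summits.HodgeConjecture.HodgeConjecture.Theorems.K2LiuSiegelEisensteinKindWPackage            -- ★ p862636 (this seat) STAGE 1 `exists_kindW_letters_of_globalLetters`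
import Summits.HodgeConjecture.HodgeConjecture.Theorems.K2LiuSiegelEisensteinKindWPresentation       -- ★ p862693 (this seat) STAGE 2 `sloc_of_presentation`, `dloc_of_presentation`
import Literature.NumberTheory.Automorphic.IdeleClassCharacterHecke                                  -- ★ `toHeckeCharacter`, `isUnitary_toHeckeCharacter` (the TOP's `μ̃ = χ_{λ⁻¹}`)
import Mathlib.RingTheory.DedekindDomain.IntegralClosure
import HarnessLib

/-!
# Crux `HLiu418`, socket #41, KIND W — `K2LiuSiegelEisensteinKindWOfRecord`: THE KIND-W BLOCK OF THE TOP OF RECORD AT THE TOP's OWN LETTERS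
# (`kindW_block_of_record` = ★ STAGE 1 ∘ ★ STAGE 2 ∘ ★ (x-a) ED. 3, hypothesis-first on the STAGE «LOCAL» residue and the per-term letters)

Cell `hodgecm-mathlib`, crux item hLiu418 = `stmt-HodgeConjecture-24832` (helper lane `--supports … --as helper`, count-neutral), route of record `HCCMUnconditional`;
squad K2 ∕ K2Liu, road `K2_Liu`, socket #41 `sig_K2LiuSiegelEisensteinContinuation`.  The TOP of record (★ ED. 17 `K2LiuSiegelEisensteinContinuationTopSeventeen`, K2E5-p17 (g9);
the KIND-W block bytes :189–209 are those of ★ ed. 16 :200–220) carries KIND W as the by-value block of 13 slots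
  `(A) (U) (hEuler) (hAd) (τ) (hτ) (NW) (hdec) {CW κ} (hCW) (hκ) (hsupp)`,
consumed by ★ p862137 `exists_whittaker_factorLetters_of_weightLetters`.  THIS FILE is the head that PAYS that block at the TOP's own letters — the datum
`(L, e, dV, hdV, hdV0, dW, hdW, hdW0)`, the character `λ` (Siegel character of record `μ̃ = toHeckeCharacter L λ⁻¹`), the Iwasawa datum `𝒦`, the standard section family `f`
with `hstd`, `hcont`, and the carrier `νN` — so that the tie replaces the 13 slots by ONE
  `obtain ⟨A, U, hEuler, hAd, τ, NW, hτ, hdec, CW, κ, hCW, hκ, hsupp⟩ := kindW_block_of_record …`.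

**`kindW_block_of_record`** is the composition of three ★ heads:
* ★ (x-a) ED. 3 `K2LiuSiegelEisensteinKindWEulerLetters.exists_kindW_eulerLetters_of_letters` (F0P2-p08 (g2)): from the Whittaker–Euler data specification
  (`T₀ νv hνK νinf hσ hmap`, `hχ`, `fT hfac`), the global integrability `hG` — PAID HERE by ★ p862776 `hG_of_isStandardSectionFamily hstd hcont` (`μ̃` is unitary,
  ★ `isUnitary_toHeckeCharacter`) —, the rank-two per-place letter `hJ` off `U(S,h)`, and the CONTINUED LOCAL LETTERS `Finf j S s h`, `Ffin j S h v s` (`j < m`) with their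
  holomorphy `hFinf`, `hFfin` and the half-plane identity `hPart` (★ p862818 `hPart_of_letters` reduces it further): `∃ A, hEuler ∧ hAd ∧ hdet0 ∧ PRES` with
  `U := fun S h => kindWPlaces ↑T₀ ↑S h` and the Σ∏ presentation PRES `A S s h = Σ_j Finf j S s h · ∏_{v ∈ kindWFinset T₀ ↑S h} Ffin j S h v s` (`det S ≠ 0`);
* ★ STAGE 2 `K2LiuSiegelEisensteinKindWPresentation.sloc_of_presentation` ∕ `dloc_of_presentation` (this seat; `ι := skewMatrices …`, `X := HA …`, `N := n + n`, `Sinf := Unit`,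
  `κT := Fin m`, `J := univ`, `Tfin S h := kindWFinset T₀ ↑S h`, `hoff` PAID by ★ (x-a) ED. 1 `integral_of_not_mem_kindWPlaces`, the least denominator `D S` CHOSEN INSIDE
  (§1, Mathlib `exists_integral_multiples`)): the PER-TERM letters BY VALUE — the per-place SUPPORT letter `hfsupp` at the places of the presentation (defect datum `(T_δ, δ, k)`),
  the ARCH size letter `harch` on `‖Finf j S s h‖` (height currency, `τ S := ‖(ι_∞ S_{ij})_{ij}‖`, archimedean determinant defect `∏_{w∣∞}(1 + |det S|_w⁻¹)^{N′}`), the FINITE size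
  letter `hfsize` on `‖∏_{v ∈ kindWFinset T₀ ↑S h} Ffin j S h v s‖` FOR EVERY admissible denominator `D` of `S` (`1 ≤ D`, `D·S` integral) — give (S-loc) and (D-loc);
* ★ STAGE 1 `K2LiuSiegelEisensteinKindWPackage.exists_kindW_letters_of_globalLetters` (this seat): (S-loc) + (D-loc) + `hdet0` + `(A, U, hEuler, hAd)` ⟹ the TOP's block verbatim.
PAYERS OF THE BY-VALUE RESIDUE (named for the tie): `hχ` (unramifiedness of `μ̃` off `T₀`) — the datum; `T₀ νv hνK νinf hσ hmap` — the carrier factorisation built by the tie as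
in ★ G1 (`K2LiuWhittakerDeltaEulerProduct`); `fT hfac`, `hJ`, `Finf Ffin hFinf hFfin hPart` — (x-a) STAGE «LOCAL» (F0P2-p08 lineage: ★ p862776, ★ p862818, per-place glue
★ `integral_unipDeltaLoc_lambdaLoc_eq_of_one_lt_re`); `hfsupp` — per-place finite support letters (K2E3-p26 ★ `K2LiuLocalHeightLevelConjugation` (c1)∕(c2));
`harch` — the archimedean chain ★ `K2LiuSiegelEisensteinKindWArchBlock.archGrowth_le_heightDecay` (LH4-p08) ∘ ★ `K2LiuSiegelEisensteinKindWBlockAtPoint` ∘ ★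
`K2LiuSiegelEisensteinKindWIndexDictionary` over the continued archimedean letter («Φ6b-ind» at indefinite indices); `hfsize` — ★ `K2LiuSiegelEisensteinKindWFinitePlaces`
(product formula for `det(D·S)` at the finite places) over the per-place finite size letters.
[MoeglinWaldspurger1995, II.1.7, IV.1.9], [KudlaRallis1994, §1–§2], [Tan1999, §2–§4], [Shimura1997, §18.4 Prop. 18.14, §19], [BorelJacquet1979, §1.2].
HONEST LABEL.  Count-neutral helper, closes no socket: `HC_CM` is proved only modulo the 7 printed citations (2 remaining named inputs: hLiu418 =
`stmt-HodgeConjecture-24832`, h413 = `stmt-HodgeConjecture-24833`) until rung 0 closes.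
-/

set_option autoImplicit false
set_option linter.dupNamespace false -- the mandated namespace repeats `HodgeConjecture.HodgeConjecture`

noncomputable section

open scoped Matrix BigOperators NNReal ENNReal ComplexConjugate RestrictedProduct
-- `Classical` is needed to see the Mathlib normed-ring instances on `mixedSpace L` (note H5 of ★ `AdelicGLnGlue`; as the TOP's `hτ`)
open scoped Classical
open NumberField NumberField.InfinitePlace IsDedekindDomain MeasureTheory Measure

namespace Summit.HodgeConjecture.HodgeConjecture.Cruxes.HLiu418.K2LiuSiegelEisensteinKindWOfRecord

open Literature.NumberTheory.Automorphic Literature.NumberTheory.GaloisRepresentations Literature.NumberTheory.LFunctions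
open Literature.NumberTheory.GelbartRogawski1991 Literature.NumberTheory.GelbartRogawski1991.GRConstruction
open Literature.NumberTheory.K2Lit.SiegelDoubled Literature.NumberTheory.K2Lit.PlaceSplitting
open Literature.MeasureTheory.RestrictedProduct
open Literature.Topology.Algebra.RestrictedProduct (inH)
open Literature.NumberTheory.Automorphic.IdeleClassGroup (toHeckeCharacter isUnitary_toHeckeCharacter)
open Summit.HodgeConjecture.HodgeConjecture.Cruxes.HLiu418.K2LiuSiegelUnipotentLocalDefs
open Summit.HodgeConjecture.HodgeConjecture.Cruxes.HLiu418.K2LiuSiegelUnipotentSplitAtDefs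
open Summit.HodgeConjecture.HodgeConjecture.Cruxes.HLiu418.K2LiuSiegelUnipotentFourierDefs
open Summit.HodgeConjecture.HodgeConjecture.Cruxes.HLiu418.K2LiuSiegelEisensteinKindWLetters (kindWPlaces kindWFinset mem_kindWFinset integral_of_not_mem_kindWPlaces)
open Summit.HodgeConjecture.HodgeConjecture.Cruxes.HLiu418.K2LiuSiegelEisensteinKindWEulerLetters (exists_kindW_eulerLetters_of_letters)
open Summit.HodgeConjecture.HodgeConjecture.Cruxes.HLiu418.K2LiuSiegelEisensteinKindWGlobalIntegrable (hG_of_isStandardSectionFamily)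
open Summit.HodgeConjecture.HodgeConjecture.Cruxes.HLiu418.K2LiuSiegelEisensteinKindWPackage (exists_kindW_letters_of_globalLetters)
open Summit.HodgeConjecture.HodgeConjecture.Cruxes.HLiu418.K2LiuSiegelEisensteinKindWPresentation (sloc_of_presentation dloc_of_presentation)

/-! ## §1 Clearing denominators: every matrix over a number field has a (least) natural denominator -/

section Den

variable (L : Type) [Field L] [NumberField L]

/-- **clearing denominators**: for a matrix `S` over a number field there is `D ≥ 1` with every `D · S_{ab}` integral over `ℤ` (a common non-zero integer multiple of the
finitely many entries, Mathlib `exists_integral_multiples`, made positive). [cite: NeukirchANT1999, Ch. I §2] -/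
theorem exists_nat_den {n : ℕ} (S : Matrix (Fin n) (Fin n) L) : ∃ D : ℕ, 1 ≤ D ∧ ∀ a b, IsIntegral ℤ ((D : L) * S a b) := by
  obtain ⟨y, hy, hint⟩ := exists_integral_multiples ℤ ℚ (Finset.univ.image fun ab : Fin n × Fin n => S ab.1 ab.2)
  refine ⟨y.natAbs, Int.natAbs_pos.2 hy, fun a b => ?_⟩
  have h := hint (S a b) (Finset.mem_image.2 ⟨(a, b), Finset.mem_univ _, rfl⟩)
  rw [Algebra.smul_def, eq_intCast] at h
  rcases Int.natAbs_eq y with hy' | hy'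
  · have hc : ((y.natAbs : ℕ) : L) = (y : L) := by rw [← Int.cast_natCast, ← hy']
    rw [hc]
    exact h
  · have hc : ((y.natAbs : ℕ) : L) = -(y : L) := by
      rw [← Int.cast_natCast, ← Int.cast_neg]
      exact congrArg (fun t : ℤ => (t : L)) (by omega)
    rw [hc, neg_mul]
    exact h.neg

/-- **the least denominator**: a `D ≥ 1` with `D · S` integral and `D ≤ D′` for every other such `D′`. [cite: NeukirchANT1999, Ch. I §2] -/
theorem exists_least_den {n : ℕ} (S : Matrix (Fin n) (Fin n) L) :
    ∃ D : ℕ, (1 ≤ D ∧ ∀ a b, IsIntegral ℤ ((D : L) * S a b)) ∧ ∀ D' : ℕ, 1 ≤ D' → (∀ a b, IsIntegral ℤ ((D' : L) * S a b)) → D ≤ D' :=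
  ⟨Nat.find (exists_nat_den L S), Nat.find_spec (exists_nat_den L S), fun _ h1 hint => Nat.find_min' _ ⟨h1, hint⟩⟩

end Den

/-! ## §2 The head of record -/

/-- **KIND W OF THE TOP OF RECORD, AT THE TOP's OWN LETTERS.**  Socket prefix `(L, e : Fin 2 × Fin 1 ≃ Fin n, dV hdV hdV0 dW hdW hdW0)`, the Siegel character of record
`μ̃ := toHeckeCharacter L λ⁻¹`, an Iwasawa datum `𝒦`, a STANDARD section family `f` (`hstd`) of continuous sections (`hcont`), the carrier `νN` (Haar on `N_Δ(𝔸)`).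
BY VALUE (hypothesis-first; payers in the module header): the (x-a) STAGE «LOCAL» residue — measurability of the split pieces, the bad set `T₀`, local carriers `νv` with
`hνK`, archimedean carriers `νinf` with `hσ`, the factorisation `hmap`, unramifiedness `hχ` of `μ̃` off `T₀`, split families `fT` with `hfac`, the rank-two per-place letter
`hJ`, the continued local letters `Finf`, `Ffin` with `hFinf`, `hFfin`, `hPart` — and the STAGE-2 per-term letters: `hfsupp` (per-place support at `v ∈ kindWFinset T₀ ↑S h`, defect
datum `(T_δ, δ, k)`), `harch` (archimedean size of `Finf j` in height currency with the determinant defect), `hfsize` (finite size of `∏_v Ffin j … v` for every admissible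
denominator).  THEN the TOP's KIND-W block (★ ED. 17 :189–209 = ★ ed. 16 :200–220, conjuncts in order):
`∃ A U, hEuler ∧ hAd ∧ ∃ τ N_W, hτ ∧ hdec ∧ ∃ C_W κ, 0 < C_W ∧ 0 ≤ κ ∧ hsupp`.
Proof: ★ `hG_of_isStandardSectionFamily` ⟶ ★ `exists_kindW_eulerLetters_of_letters` ⟶ ★ `sloc_of_presentation` (+ ★ `integral_of_not_mem_kindWPlaces`) ⟶ §1 least denominators ⟶
★ `dloc_of_presentation` ⟶ ★ `exists_kindW_letters_of_globalLetters`.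
[cite: MoeglinWaldspurger1995, II.1.7, IV.1.9] [cite: KudlaRallis1994, §1] [cite: Tan1999, §4 Prop. 4.8] [cite: Shimura1997, §18.4 Prop. 18.14] [cite: BorelJacquet1979, §1.2] -/
theorem kindW_block_of_record
    (L : Type) [Field L] [NumberField L] [IsCMField L] {n : ℕ} (e : Fin 2 × Fin 1 ≃ Fin n)
    (dV : Fin 2 → L) (hdV : ∀ i, IsCMField.complexConj L (dV i) = dV i) (hdV0 : ∀ i, dV i ≠ 0)
    (dW : Fin 1 → L) (hdW : ∀ i, IsCMField.complexConj L (dW i) = dW i) (hdW0 : ∀ i, dW i ≠ 0)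
    (lam : IdeleClassGroup L →ₜ* Circle) (𝒦 : IwasawaDatum L e dV hdV dW hdW) (f : ℂ → HA L e dV hdV dW hdW → ℂ)
    (hstd : IsStandardSectionFamily 𝒦 (toHeckeCharacter L lam⁻¹) f) (hcont : ∀ s, Continuous (f s))
    [MeasurableSpace (unipDelta L e dV hdV dW hdW)] [BorelSpace (unipDelta L e dV hdV dW hdW)]
    (νN : Measure (unipDelta L e dV hdV dW hdW)) [νN.IsHaarMeasure]
    -- (x-a) STAGE «LOCAL» BY VALUE: measurability of the split pieces, the bad set `T₀`, the local ∕ archimedean carriers and the factorisation of `νN` (★ G1's specification)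
    [DecidableEq (HeightOneSpectrum (𝓞 (Fp L)))]
    [MeasurableSpace (unipDeltaArch L e dV hdV dW hdW)] [BorelSpace (unipDeltaArch L e dV hdV dW hdW)]
    [∀ v : HeightOneSpectrum (𝓞 (Fp L)), MeasurableSpace (unipDeltaLoc L e dV hdV dW hdW v)]
    [∀ v : HeightOneSpectrum (𝓞 (Fp L)), BorelSpace (unipDeltaLoc L e dV hdV dW hdW v)]
    (T₀ : Finset (HeightOneSpectrum (𝓞 (Fp L))))
    (νv : ∀ v : HeightOneSpectrum (𝓞 (Fp L)), Measure (unipDeltaLoc L e dV hdV dW hdW v)) [∀ v, (νv v).IsHaarMeasure] [∀ v, SigmaFinite (νv v)]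
    (hνK : ∀ v, νv v (((inH (fun v => UnitaryGroup.localInt L (IsCMField.complexConj L) (n + n) (hermD L e dV hdV dW hdW) v)
      (fun v => unipDeltaLoc L e dV hdV dW hdW v) v) : Subgroup (unipDeltaLoc L e dV hdV dW hdW v)) : Set (unipDeltaLoc L e dV hdV dW hdW v)) = 1)
    (νinf : Finset (HeightOneSpectrum (𝓞 (Fp L))) → Measure (unipDeltaArch L e dV hdV dW hdW)) (hσ : ∀ T, SigmaFinite (νinf T))
    (hmap : ∀ T : Finset (HeightOneSpectrum (𝓞 (Fp L))), Measure.map (unipDeltaSplitAt L e dV hdV dW hdW T) νN =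
      (νinf T).prod ((Measure.pi fun v : T => νv v.1).prod
        (rpMeasure (fun v : {v : HeightOneSpectrum (𝓞 (Fp L)) // v ∉ T} => ((inH (fun v => UnitaryGroup.localInt L (IsCMField.complexConj L) (n + n) (hermD L e dV hdV dW hdW) v)
          (fun v => unipDeltaLoc L e dV hdV dW hdW v) v.1 : Subgroup (unipDeltaLoc L e dV hdV dW hdW v.1)) : Set (unipDeltaLoc L e dV hdV dW hdW v.1))) (fun v => νv v.1) ∅)))
    -- unramifiedness of `μ̃` off `T₀`; the split families of `f` off every `T ⊇ T₀`
    (hχ : ∀ v, v ∉ T₀ → ∀ w' : UnitaryGroup.PlacesOver L v, (toHeckeCharacter L lam⁻¹).IsUnramifiedAt w'.1)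
    {fT : ∀ T : Finset (HeightOneSpectrum (𝓞 (Fp L))), ℂ → UnitaryGroup.arch (Fp L) L (IsCMField.complexConj L) (n + n) (hermD L e dV hdV dW hdW) ×
      (Π v : T, UnitaryGroup.localPi L (IsCMField.complexConj L) (n + n) (hermD L e dV hdV dW hdW) v.1) → ℂ}
    (hfac : ∀ T : Finset (HeightOneSpectrum (𝓞 (Fp L))), T₀ ⊆ T → IsFactorizableOff L e dV hdV dW hdW T (toHeckeCharacter L lam⁻¹) f (fT T))
    -- the rank-two per-place letter off `U(S,h)`
    (hJ : ∀ (S : skewMatrices ((IsCMField.complexConj L : L ≃ₐ[Fp L] L) : L →+* L) ((gramR L e dV hdV dW hdW).map (algebraMap (Fp L) L))) (h : HA L e dV hdV dW hdW) (s : ℂ),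
      (n : ℝ) / 2 < s.re → (S : Matrix (Fin n) (Fin n) L).det ≠ 0 →
      ∀ v, v ∉ kindWPlaces L e dV hdV dW hdW (T₀ : Set (HeightOneSpectrum (𝓞 (Fp L)))) (S : Matrix (Fin n) (Fin n) L) h →
        ∫ y, conj (unipDeltaChar L e dV hdV dW hdW (S : Matrix (Fin n) (Fin n) L)
              (locToAdelic L e dV hdV dW hdW v (y : UnitaryGroup.localPi L (IsCMField.complexConj L) (n + n) (hermD L e dV hdV dW hdW) v)) : ℂ) *
            LambdaLoc L e dV hdV dW hdW v (toHeckeCharacter L lam⁻¹) s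
              (UnitaryGroup.evalPlace (Fp L) L (IsCMField.complexConj L) (n + n) (hermD L e dV hdV dW hdW) v
                  (UnitaryGroup.finPart (Fp L) L (IsCMField.complexConj L) (n + n) (hermD L e dV hdV dW hdW) (weylDelta L e dV hdV dW hdW)) *
                (y : UnitaryGroup.localPi L (IsCMField.complexConj L) (n + n) (hermD L e dV hdV dW hdW) v)) ∂(νv v) =
          (1 - (v.residueCard : ℂ) ^ (-(2 * s + 1))) * (1 - (quadraticHeckeCharCM L).valueAtUniformizer v * (v.residueCard : ℂ) ^ (-(2 * s + 2))))
    -- the CONTINUED local letters (by value) and their holomorphy on `{0 < re s}`, with the half-plane identity `hPart`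
    {m : ℕ} (Finf : Fin m → skewMatrices ((IsCMField.complexConj L : L ≃ₐ[Fp L] L) : L →+* L) ((gramR L e dV hdV dW hdW).map (algebraMap (Fp L) L)) → ℂ → HA L e dV hdV dW hdW → ℂ)
    (Ffin : Fin m → skewMatrices ((IsCMField.complexConj L : L ≃ₐ[Fp L] L) : L →+* L) ((gramR L e dV hdV dW hdW).map (algebraMap (Fp L) L)) → HA L e dV hdV dW hdW →
      HeightOneSpectrum (𝓞 (Fp L)) → ℂ → ℂ)
    (hFinf : ∀ j S (h : HA L e dV hdV dW hdW), DifferentiableOn ℂ (fun s => Finf j S s h) {s : ℂ | 0 < s.re})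
    (hFfin : ∀ j S (h : HA L e dV hdV dW hdW) v, DifferentiableOn ℂ (Ffin j S h v) {s : ℂ | 0 < s.re})
    (hPart : ∀ (S : skewMatrices ((IsCMField.complexConj L : L ≃ₐ[Fp L] L) : L →+* L) ((gramR L e dV hdV dW hdW).map (algebraMap (Fp L) L))) (h : HA L e dV hdV dW hdW) (s : ℂ),
      (n : ℝ) / 2 < s.re → (S : Matrix (Fin n) (Fin n) L).det ≠ 0 →
      K2LiuSiegelEisensteinKindWLetters.kindWPart L e dV hdV dW hdW (kindWFinset L e dV hdV dW hdW T₀ (S : Matrix (Fin n) (Fin n) L) h)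
          (νinf (kindWFinset L e dV hdV dW hdW T₀ (S : Matrix (Fin n) (Fin n) L) h)) νv
          (fT (kindWFinset L e dV hdV dW hdW T₀ (S : Matrix (Fin n) (Fin n) L) h)) (S : Matrix (Fin n) (Fin n) L) s h =
        ∑ j, Finf j S s h * ∏ v ∈ kindWFinset L e dV hdV dW hdW T₀ (S : Matrix (Fin n) (Fin n) L) h, Ffin j S h v s)
    -- STAGE 2, the per-term letters BY VALUE: per-place support at the places of the presentation (defect datum `(T_δ, δ, k)`)
    (Tδ : Finset (HeightOneSpectrum (𝓞 L))) (δ : HeightOneSpectrum (𝓞 L) → ℕ) (hδ : ∀ w ∉ Tδ, δ w = 0) (k : ℕ)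
    (hfsupp : ∀ (v : HeightOneSpectrum (𝓞 (Fp L))) (j : Fin m)
      (S : skewMatrices ((IsCMField.complexConj L : L ≃ₐ[Fp L] L) : L →+* L) ((gramR L e dV hdV dW hdW).map (algebraMap (Fp L) L))) (s : ℂ) (h : HA L e dV hdV dW hdW),
      v ∈ kindWFinset L e dV hdV dW hdW T₀ (S : Matrix (Fin n) (Fin n) L) h → 0 < s.re → Ffin j S h v s ≠ 0 →
      ∀ w : UnitaryGroup.PlacesOver L v, ∃ m : ℕ,
        ((Ideal.absNorm w.1.asIdeal : ℕ) : ℝ) ^ m ≤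
            ((Ideal.absNorm w.1.asIdeal : ℕ) : ℝ) ^ δ w.1 * (GLn.localHeight (n + n) L w.1 (h : GL (Fin (n + n)) (AdeleRing (𝓞 L) L)) : ℝ) ^ k ∧
          ∀ a b, Valued.v ((((S : Matrix (Fin n) (Fin n) L) a b : L)) : w.1.adicCompletion L) ≤ WithZero.exp (m : ℤ))
    -- the ARCH size letter on `Finf j` (height currency, `τ S := ‖(ι_∞ S_{ij})_{ij}‖`, determinant defect) and the FINITE size letter on `∏_v Ffin j … v` (every admissible `D`)
    (N₁ N' N₂ N₃ : ℕ)
    (harch : ∀ z : ℂ, 0 < z.re → ∃ C a c a' r : ℝ, 0 ≤ C ∧ 0 ≤ a ∧ 0 < c ∧ 0 ≤ a' ∧ 0 < r ∧ ∀ (j : Fin m)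
      (S : skewMatrices ((IsCMField.complexConj L : L ≃ₐ[Fp L] L) : L →+* L) ((gramR L e dV hdV dW hdW).map (algebraMap (Fp L) L))) (s : ℂ),
      dist s z < r → ∀ h : HA L e dV hdV dW hdW,
      ‖Finf j S s h‖ ≤ C * adelicHeightGL (n + n) L (h : GL (Fin (n + n)) (AdeleRing (𝓞 L) L)) ^ a *
        (Real.exp (-(c * adelicHeightGL (n + n) L (h : GL (Fin (n + n)) (AdeleRing (𝓞 L) L)) ^ (-a') *
            ‖(fun i j => NumberField.mixedEmbedding L ((S : Matrix (Fin n) (Fin n) L) i j))‖)) *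
          (1 + ‖(fun i j => NumberField.mixedEmbedding L ((S : Matrix (Fin n) (Fin n) L) i j))‖) ^ N₁) *
        ∏ w : InfinitePlace L, (1 + (w (S : Matrix (Fin n) (Fin n) L).det)⁻¹) ^ N')
    (hfsize : ∀ z : ℂ, 0 < z.re → ∃ C a r : ℝ, 0 ≤ C ∧ 0 ≤ a ∧ 0 < r ∧ ∀ (j : Fin m)
      (S : skewMatrices ((IsCMField.complexConj L : L ≃ₐ[Fp L] L) : L →+* L) ((gramR L e dV hdV dW hdW).map (algebraMap (Fp L) L))) (s : ℂ),
      dist s z < r → ∀ (h : HA L e dV hdV dW hdW) (D : ℕ), 1 ≤ D → (∀ a b, IsIntegral ℤ ((D : L) * (S : Matrix (Fin n) (Fin n) L) a b)) →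
      ‖∏ v ∈ kindWFinset L e dV hdV dW hdW T₀ (S : Matrix (Fin n) (Fin n) L) h, Ffin j S h v s‖ ≤
        C * adelicHeightGL (n + n) L (h : GL (Fin (n + n)) (AdeleRing (𝓞 L) L)) ^ a *
          (1 + ‖(fun i j => NumberField.mixedEmbedding L ((S : Matrix (Fin n) (Fin n) L) i j))‖) ^ N₂ * (D : ℝ) ^ N₃) :
    ∃ (A : skewMatrices ((IsCMField.complexConj L : L ≃ₐ[Fp L] L) : L →+* L) ((gramR L e dV hdV dW hdW).map (algebraMap (Fp L) L)) → ℂ → HA L e dV hdV dW hdW → ℂ)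
      (U : skewMatrices ((IsCMField.complexConj L : L ≃ₐ[Fp L] L) : L →+* L) ((gramR L e dV hdV dW hdW).map (algebraMap (Fp L) L)) → HA L e dV hdV dW hdW →
        Set (HeightOneSpectrum (𝓞 ↥(maximalRealSubfield L)))),
      (∀ S : skewMatrices ((IsCMField.complexConj L : L ≃ₐ[Fp L] L) : L →+* L) ((gramR L e dV hdV dW hdW).map (algebraMap (Fp L) L)),
        (S : Matrix (Fin n) (Fin n) L).det ≠ 0 → ∀ (s : ℂ) (h : HA L e dV hdV dW hdW), (n : ℝ) / 2 < s.re →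
          whittakerDelta L e dV hdV dW hdW νN (S : Matrix (Fin n) (Fin n) L) (f s) h =
            A S s h * (partialStandardL (U S h) (fun _ => {1}) (2 * s + 1) *
              partialStandardL (U S h) (fun v => {(quadraticHeckeCharCM L).valueAtUniformizer v}) (2 * s + 2))⁻¹) ∧
      (∀ S (h : HA L e dV hdV dW hdW), DifferentiableOn ℂ (fun s => A S s h) {s : ℂ | 0 < s.re}) ∧
      ∃ (τ : skewMatrices ((IsCMField.complexConj L : L ≃ₐ[Fp L] L) : L →+* L) ((gramR L e dV hdV dW hdW).map (algebraMap (Fp L) L)) → ℝ) (NW : ℕ),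
        (∀ S : skewMatrices ((IsCMField.complexConj L : L ≃ₐ[Fp L] L) : L →+* L) ((gramR L e dV hdV dW hdW).map (algebraMap (Fp L) L)),
          ‖(fun i j => NumberField.mixedEmbedding L ((S : Matrix (Fin n) (Fin n) L) i j))‖ ≤ τ S) ∧
        (∀ z : ℂ, 0 < z.re → ∃ C a c a' r : ℝ, 0 ≤ C ∧ 0 ≤ a ∧ 0 < c ∧ 0 ≤ a' ∧ 0 < r ∧ ∀ S (s : ℂ), dist s z < r → ∀ h : HA L e dV hdV dW hdW,
          ‖A S s h‖ ≤ C * adelicHeightGL (n + n) L (h : GL (Fin (n + n)) (AdeleRing (𝓞 L) L)) ^ a *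
            (Real.exp (-(c * adelicHeightGL (n + n) L (h : GL (Fin (n + n)) (AdeleRing (𝓞 L) L)) ^ (-a') * τ S)) * (1 + τ S) ^ NW)) ∧
        ∃ CW κ : ℝ, 0 < CW ∧ 0 ≤ κ ∧
          ∀ S (s : ℂ) (h : HA L e dV hdV dW hdW), 0 < s.re → A S s h ≠ 0 →
            ∃ D : ℕ, 1 ≤ D ∧ (D : ℝ) ≤ CW * adelicHeightGL (n + n) L (h : GL (Fin (n + n)) (AdeleRing (𝓞 L) L)) ^ κ ∧
              ∀ i j, IsIntegral ℤ ((D : L) * (S : Matrix (Fin n) (Fin n) L) i j) := by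
  have hn : 0 < n := by
    have h2 : Fintype.card (Fin 2 × Fin 1) = Fintype.card (Fin n) := Fintype.card_congr e
    simp only [Fintype.card_prod, Fintype.card_fin] at h2
    omega
  haveI : NeZero (n + n) := ⟨by omega⟩
  -- (x-a) ED. 3 at the TOP's letters: `hG` ★ p862776 (`μ̃ = χ_{λ⁻¹}` is unitary)
  have hG := hG_of_isStandardSectionFamily L e dV hdV dW hdW hdV0 hdW0 (isUnitary_toHeckeCharacter L lam⁻¹) 𝒦 hstd hcont νN
  obtain ⟨A, hEuler, hAd, hdet0, hpres⟩ :=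
    exists_kindW_eulerLetters_of_letters L e dV hdV dW hdW T₀ νN νv hνK νinf hσ hmap hχ hfac hG hJ Finf Ffin hFinf hFfin hPart
  -- the Σ∏ presentation in STAGE-2 shape (`Sinf := Unit`, `κT := Fin m`, `J := univ`, `Tfin S h := kindWFinset T₀ ↑S h`)
  have hpres' : ∀ (S : skewMatrices ((IsCMField.complexConj L : L ≃ₐ[Fp L] L) : L →+* L) ((gramR L e dV hdV dW hdW).map (algebraMap (Fp L) L)))
      (s : ℂ) (h : HA L e dV hdV dW hdW), (S : Matrix (Fin n) (Fin n) L).det ≠ 0 → 0 < s.re →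
      A S s h = ∑ j ∈ (Finset.univ : Finset (Fin m)), (∏ _σ : Unit, Finf j S s h) *
        ∏ v ∈ kindWFinset L e dV hdV dW hdW T₀ (S : Matrix (Fin n) (Fin n) L) h, Ffin j S h v s := by
    intro S s h hdet _
    rw [hpres S h s hdet]
    refine Finset.sum_congr rfl fun j _ => ?_
    rw [Fintype.prod_subsingleton _ ()]
  -- integrality of the entries of `S` above the places off `kindWFinset T₀ ↑S h` (★ (x-a) ED. 1)
  have hoff : ∀ (S : skewMatrices ((IsCMField.complexConj L : L ≃ₐ[Fp L] L) : L →+* L) ((gramR L e dV hdV dW hdW).map (algebraMap (Fp L) L)))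
      (h : HA L e dV hdV dW hdW) (v : HeightOneSpectrum (𝓞 (Fp L))), v ∉ kindWFinset L e dV hdV dW hdW T₀ (S : Matrix (Fin n) (Fin n) L) h →
      ∀ (w : UnitaryGroup.PlacesOver L v) (a b : Fin n), ((((S : Matrix (Fin n) (Fin n) L) a b : L)) : w.1.adicCompletion L) ∈ w.1.adicCompletionIntegers L :=
    fun S h v hv w a b => integral_of_not_mem_kindWPlaces L e dV hdV dW hdW (fun hv' => hv ((mem_kindWFinset L e dV hdV dW hdW).2 hv')) w a b
  -- (S-loc): ★ STAGE 2 §2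
  have hSloc := sloc_of_presentation L (N := n + n)
    (fun S : skewMatrices ((IsCMField.complexConj L : L ≃ₐ[Fp L] L) : L →+* L) ((gramR L e dV hdV dW hdW).map (algebraMap (Fp L) L)) => (S : Matrix (Fin n) (Fin n) L))
    (fun h : HA L e dV hdV dW hdW => (h : GL (Fin (n + n)) (AdeleRing (𝓞 L) L))) A hdet0
    (fun _ _ => (Finset.univ : Finset (Fin m))) (fun S h => kindWFinset L e dV hdV dW hdW T₀ (S : Matrix (Fin n) (Fin n) L) h)
    (fun (_ : Unit) (j : Fin m) S s h => Finf j S s h) (fun v j S s h => Ffin j S h v s) hpres' δ k hfsupp hoff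
  -- the least denominators (§1)
  choose D hD hDmin using fun S : skewMatrices ((IsCMField.complexConj L : L ≃ₐ[Fp L] L) : L →+* L) ((gramR L e dV hdV dW hdW).map (algebraMap (Fp L) L)) =>
    exists_least_den L (S : Matrix (Fin n) (Fin n) L)
  -- the per-term letters in STAGE-2 shape
  have harch' : ∀ z : ℂ, 0 < z.re → ∃ C a c a' r : ℝ, 0 ≤ C ∧ 0 ≤ a ∧ 0 < c ∧ 0 ≤ a' ∧ 0 < r ∧ ∀ (j : Fin m)
      (S : skewMatrices ((IsCMField.complexConj L : L ≃ₐ[Fp L] L) : L →+* L) ((gramR L e dV hdV dW hdW).map (algebraMap (Fp L) L))) (s : ℂ),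
      dist s z < r → ∀ h : HA L e dV hdV dW hdW,
      ‖∏ _σ : Unit, Finf j S s h‖ ≤ C * adelicHeightGL (n + n) L (h : GL (Fin (n + n)) (AdeleRing (𝓞 L) L)) ^ a *
        (Real.exp (-(c * adelicHeightGL (n + n) L (h : GL (Fin (n + n)) (AdeleRing (𝓞 L) L)) ^ (-a') *
            ‖(fun i j => NumberField.mixedEmbedding L ((S : Matrix (Fin n) (Fin n) L) i j))‖)) *
          (1 + ‖(fun i j => NumberField.mixedEmbedding L ((S : Matrix (Fin n) (Fin n) L) i j))‖) ^ N₁) *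
        ∏ w : InfinitePlace L, (1 + (w (S : Matrix (Fin n) (Fin n) L).det)⁻¹) ^ N' := by
    intro z hz
    obtain ⟨C, a, c, a', r, hC, ha, hc, ha', hr, hb⟩ := harch z hz
    refine ⟨C, a, c, a', r, hC, ha, hc, ha', hr, fun j S s hs h => ?_⟩
    rw [Fintype.prod_subsingleton _ ()]
    exact hb j S s hs h
  have hfsize' : ∀ z : ℂ, 0 < z.re → ∃ C a r : ℝ, 0 ≤ C ∧ 0 ≤ a ∧ 0 < r ∧ ∀ (j : Fin m)
      (S : skewMatrices ((IsCMField.complexConj L : L ≃ₐ[Fp L] L) : L →+* L) ((gramR L e dV hdV dW hdW).map (algebraMap (Fp L) L))) (s : ℂ),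
      dist s z < r → ∀ h : HA L e dV hdV dW hdW,
      ‖∏ v ∈ kindWFinset L e dV hdV dW hdW T₀ (S : Matrix (Fin n) (Fin n) L) h, Ffin j S h v s‖ ≤
        C * adelicHeightGL (n + n) L (h : GL (Fin (n + n)) (AdeleRing (𝓞 L) L)) ^ a *
          (1 + ‖(fun i j => NumberField.mixedEmbedding L ((S : Matrix (Fin n) (Fin n) L) i j))‖) ^ N₂ * (D S : ℝ) ^ N₃ := by
    intro z hz
    obtain ⟨C, a, r, hC, ha, hr, hb⟩ := hfsize z hz
    exact ⟨C, a, r, hC, ha, hr, fun j S s hs h => hb j S s hs h (D S) (hD S).1 (hD S).2⟩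
  -- (D-loc): ★ STAGE 2 §3
  have hDloc := dloc_of_presentation L (N := n + n)
    (fun S : skewMatrices ((IsCMField.complexConj L : L ≃ₐ[Fp L] L) : L →+* L) ((gramR L e dV hdV dW hdW).map (algebraMap (Fp L) L)) => (S : Matrix (Fin n) (Fin n) L))
    (fun h : HA L e dV hdV dW hdW => (h : GL (Fin (n + n)) (AdeleRing (𝓞 L) L))) A
    (fun S => ‖(fun i j => NumberField.mixedEmbedding L ((S : Matrix (Fin n) (Fin n) L) i j))‖) (fun S => norm_nonneg _) hdet0
    (fun _ _ => (Finset.univ : Finset (Fin m))) m (fun _ _ => by simp) (fun S h => kindWFinset L e dV hdV dW hdW T₀ (S : Matrix (Fin n) (Fin n) L) h)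
    (fun (_ : Unit) (j : Fin m) S s h => Finf j S s h) (fun v j S s h => Ffin j S h v s) hpres' Tδ δ hδ k hSloc D hDmin N₁ N' N₂ N₃ harch' hfsize'
  -- STAGE 1
  exact exists_kindW_letters_of_globalLetters L e dV hdV dW hdW νN f A
    (fun S h => kindWPlaces L e dV hdV dW hdW (T₀ : Set (HeightOneSpectrum (𝓞 (Fp L)))) (S : Matrix (Fin n) (Fin n) L) h)
    hEuler hAd hdet0 Tδ δ hδ k hSloc (N₁ + N₂) N' hDloc

end Summit.HodgeConjecture.HodgeConjecture.Cruxes.HLiu418.K2LiuSiegelEisensteinKindWOfRecord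

end
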